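import Summits.KontsevichZagierPeriods.KontsevichZagierPeriods.Theorems.SoloBlindAngleCells
import Summits.KontsevichZagierPeriods.KontsevichZagierPeriods.Theorems.SoloBlindTanChart
import Summits.KontsevichZagierPeriods.KontsevichZagierPeriods.Theorems.SoloBlindEta
import HarnessLib

/-!
# `ζ(4) = π⁴/90` inside the Kontsevich–Zagier rules

Let `B₄ = [(0,1)⁴, 1/(1 - x₀x₁x₂x₃)]` be the box representation of `ζ(4)` (`SoloBlindStuffle`)
and `x_π = 4·[A(1;1)]` the class of `π` in the period ring `Q = FormalRep/relations`
(`SoloBlindZetaTwoSquare`).  We prove **`90·[B₄] = x_π⁴` in `Q`** (`nsmul_mkQ_boxFour`), i.e.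
the two formal representations differ by an explicit finite chain of Kontsevich–Zagier moves:

1. `[B₄] = [Λ] + [M]` and `[B₄] = 16·[M]`, `Λ = [(0,1)⁴, 1/(1-P²)]`, `M = [(0,1)⁴, P/(1-P²)]`,
   `P = x₀x₁x₂x₃` (rule (1) and the squares chart, `SoloBlindEta`);
2. `[Λ] = [T, w]` (rule (2): the cyclic tangent chart of `SoloBlindTanChart`, whose Jacobian
   `(1 - (∏Φ)²)·w` absorbs the integrand — the Beukers–Kolk–Calabi change of variables);
3. `x_π⁴ = 96·[T, w]` (`SoloBlindAngleCells`: three dissections, one transfer chart, and the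
   product rule `[(0,1)⁴, w] = (2·[A(1;1)])⁴`).

Hence `15·[B₄] = 16·[Λ]` and `90·[B₄] = 96·[T,w] = x_π⁴`.  Consequences: `B₄`, `Λ`, the
alternating box `A₄ = [(0,1)⁴, 1/(1+P)]`, `[T, w]` and the box representation `B_(2,2)` of
`ζ(2,2)` (via the stuffle `[B₂]² = 2[B_(2,2)] + [B₄]`) lie in the `π`-sector `M_π`, on which the
Kontsevich–Zagier conjecture holds (`kz_piSector`): **any two of these representations, their
products and `K₀[x_π]`-combinations with equal values are KZ-equivalent** (`kz_boxFour`), and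
Euler's `ζ(4) = π⁴/90`, `η(4) = 7π⁴/720`, `λ(4) = π⁴/96` are read off by evaluating
(`boxFour_value`, `altRep_value`, `tanPiece_value`; `ζ(4) = π⁴/90` itself is then
`boxZetaRep_value`).
-/

noncomputable section

namespace Summit.KontsevichZagierPeriods.KontsevichZagierPeriods.Theorems

open Set MeasureTheory
open Literature.ModelTheory.ExponentialFields (IsSemialgebraic)
open MvPolynomial (aeval X C)
open Literature.NumberTheory.Transcendental
open Literature.NumberTheory.Transcendental.KZ

namespace SoloBlind

/-! ## The representations `Λ = Λ'₄`, `M = M₄` (from `SoloBlindEta`) -/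

/-- `Λ = [(0,1)⁴, 1/(1-P²)]`, the even part of `B₄`. -/
abbrev evenRep : IntegralRep 4 := evenBoxRep 4 (by norm_num)

/-- `M = [(0,1)⁴, P/(1-P²)]`, the odd part of `B₄`. -/
abbrev oddRep : IntegralRep 4 := oddBoxRep 4 (by norm_num)

/-- `A₄ = [(0,1)⁴, 1/(1+P)]`, the alternating box (`η(4) = 7π⁴/720`). -/
abbrev altRep : IntegralRep 4 := altBoxRep 4 (by norm_num)

/-- **`[B₄] = 16·[M]` in `Q`** (rule (2) along the squares chart, `SoloBlindEta`). -/
theorem mkQ_boxFour_eq_odd : mkQ (of boxFour) = 2 ^ 4 • mkQ (of oddRep) :=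
  mkQ_box_eq_odd (by norm_num)

/-- **`[B₄] = [Λ] + [M]` in `Q`** (rule (1)). -/
theorem mkQ_boxFour_eq_add : mkQ (of boxFour) = mkQ (of evenRep) + mkQ (of oddRep) :=
  mkQ_box_eq_add (by norm_num)

/-! ## The moves -/

/-- **Rule (2) along the cyclic tangent chart** (Beukers–Kolk–Calabi): `[T, w] ≡ Λ`. -/
theorem tanPiece_equiv_evenRep : Equivalent tanPiece evenRep :=
  equivalent_of_tanChart (f := tanWeight) (g := fun x => 1 / (1 - (∏ i, x i) ^ 2))
    (fun t ht => by
      have h := (one_sub_prod_sq_pos (n := 4) (by norm_num) (tanChart_mem ht)).ne'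
      rw [tanWeight_eq]
      field_simp)
    rfl (fun t _ => by simp [tanPiece]) rfl fun _ _ => rfl

/-! ## `90·[B₄] = x_π⁴` and its consequences -/

/-- **`ζ(4) = π⁴/90` inside the rules: `90·[B₄] = x_π⁴` in `Q`.** -/
theorem nsmul_mkQ_boxFour : 90 • mkQ (of boxFour) = xPi ^ 4 := by
  have h1 := mkQ_boxFour_eq_add
  have h2 := mkQ_boxFour_eq_odd
  rw [xPi_pow_four, mkQ_eq_mkQ_iff.mpr tanPiece_equiv_evenRep]
  simp only [nsmul_eq_mul, Nat.cast_pow, Nat.cast_ofNat] at h2 ⊢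
  linear_combination (96 : Q) * h1 - (6 : Q) * h2

/-- `[B₄] = (1/90)·x_π⁴` in `Q`. -/
theorem mkQ_boxFour : mkQ (of boxFour) = (90 : K₀)⁻¹ • xPi ^ 4 := by
  rw [← nsmul_mkQ_boxFour, ← Nat.cast_smul_eq_nsmul K₀, Nat.cast_ofNat,
    inv_smul_smul₀ (by norm_num : (90 : K₀) ≠ 0)]

/-- **`B₄` lies in the `π`-sector `M_π`.** -/
theorem of_boxFour_mem_piSector : of boxFour ∈ piSector := by
  rw [mem_piSector, mkQ_boxFour]
  exact Subalgebra.smul_mem _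
    (Subalgebra.pow_mem _ (Algebra.self_mem_adjoin_singleton K₀ xPi) 4) _

/-- **`B_(2,2)` lies in `M_π`** (from the stuffle `[B₂]² = 2[B_(2,2)] + [B₄]`). -/
theorem of_boxTwoTwo_mem_piSector : of boxTwoTwo ∈ piSector := by
  have h2 : mkQ (of boxTwoTwo) =
      (2 : K₀)⁻¹ • (mkQ (of boxTwo) * mkQ (of boxTwo) - mkQ (of boxFour)) := by
    rw [mkQ_boxTwo_sq, add_sub_cancel_right, ← Nat.cast_smul_eq_nsmul K₀, Nat.cast_ofNat,
      inv_smul_smul₀ (by norm_num : (2 : K₀) ≠ 0)]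
  rw [mem_piSector, h2]
  exact Subalgebra.smul_mem _ (Subalgebra.sub_mem _ (Subalgebra.mul_mem _
    (mem_piSector.mp of_boxTwo_mem_piSector) (mem_piSector.mp of_boxTwo_mem_piSector))
    (mem_piSector.mp of_boxFour_mem_piSector)) _

/-- A class `z` with `a • z = b • w`, `a ≠ 0`, `w ∈ K₀[x_π]`, lies in `K₀[x_π]`. -/
theorem mem_adjoin_xPi_of_nsmul_eq {z w : Q} (hw : w ∈ Algebra.adjoin K₀ {xPi}) {a b : ℕ}
    (ha : a ≠ 0) (h : a • z = b • w) : z ∈ Algebra.adjoin K₀ {xPi} := by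
  have hz : z = (a : K₀)⁻¹ • (b • w) := by
    rw [← h, ← Nat.cast_smul_eq_nsmul K₀ a, inv_smul_smul₀ (Nat.cast_ne_zero.mpr ha)]
  rw [hz]
  exact Subalgebra.smul_mem _ (Subalgebra.nsmul_mem _ hw _) _

/-- **`A₄ = [(0,1)⁴, 1/(1+P)]` lies in `M_π`** (`16[A₄] = 14[B₄]`, `SoloBlindEta`). -/
theorem of_altRep_mem_piSector : of altRep ∈ piSector :=
  mem_piSector.mpr (mem_adjoin_xPi_of_nsmul_eq (mem_piSector.mp of_boxFour_mem_piSector)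
    (a := 2 ^ 4) (by norm_num) (nsmul_mkQ_altBox (by norm_num)))

/-- **`Λ = [(0,1)⁴, 1/(1-P²)]` lies in `M_π`** (`16[Λ] = 15[B₄]`). -/
theorem of_evenRep_mem_piSector : of evenRep ∈ piSector :=
  mem_piSector.mpr (mem_adjoin_xPi_of_nsmul_eq (mem_piSector.mp of_boxFour_mem_piSector)
    (a := 2 ^ 4) (by norm_num) (nsmul_mkQ_evenBox (by norm_num)))

/-- **`[T, w]` (the tangent cell with the angle weight) lies in `M_π`.** -/
theorem of_tanPiece_mem_piSector : of tanPiece ∈ piSector := by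
  rw [mem_piSector, mkQ_eq_mkQ_iff.mpr tanPiece_equiv_evenRep]
  exact mem_piSector.mp of_evenRep_mem_piSector

/-- **The Kontsevich–Zagier conjecture for `B₄` against the `π`-sector**: every representation
in `M_π` (e.g. `B_(2,2)`, `B₂ × B₂`, `x_π⁴`-multiples of cells, …) with the value `ζ(4)` is
KZ-equivalent to `B₄`. -/
theorem kz_boxFour {m : ℕ} (r' : IntegralRep m) (hr' : of r' ∈ piSector)
    (hv : boxFour.value = r'.value) : Equivalent boxFour r' :=
  kz_piSector _ _ of_boxFour_mem_piSector hr' hv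

/-- **Euler's `ζ(4) = π⁴/90` in the form `∫ B₄ = π⁴/90`, read off from the moves** (soundness
of the calculus; `∫ B₄ = ζ(4)` is `boxZetaRep_value`). -/
theorem boxFour_value : boxFour.value = Real.pi ^ 4 / 90 := by
  have h := congrArg evalQ nsmul_mkQ_boxFour
  rw [map_nsmul, map_pow, evalQ_xPi, evalQ_mkQ, eval_of, nsmul_eq_mul] at h
  push_cast at h
  linarith

/-- `∫_{(0,1)⁴} dx/(1+x₀x₁x₂x₃) = η(4) = 7π⁴/720`, read off from the moves. -/
theorem altRep_value : altRep.value = 7 * Real.pi ^ 4 / 720 := by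
  have h := congrArg evalQ (nsmul_mkQ_altBox (n := 4) (by norm_num))
  have hB : (boxZetaRep 4 (by norm_num)).value = Real.pi ^ 4 / 90 := boxFour_value
  rw [map_nsmul, map_nsmul, evalQ_mkQ, evalQ_mkQ, eval_of, eval_of, hB, nsmul_eq_mul,
    nsmul_eq_mul] at h
  push_cast at h
  linarith

/-- `∫_{(0,1)⁴} dx/(1-(x₀x₁x₂x₃)²) = λ(4) = π⁴/96`, read off from the moves. -/
theorem evenRep_value : evenRep.value = Real.pi ^ 4 / 96 := by
  have h := congrArg evalQ (nsmul_mkQ_evenBox (n := 4) (by norm_num))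
  have hB : (boxZetaRep 4 (by norm_num)).value = Real.pi ^ 4 / 90 := boxFour_value
  rw [map_nsmul, map_nsmul, evalQ_mkQ, evalQ_mkQ, eval_of, eval_of, hB, nsmul_eq_mul,
    nsmul_eq_mul] at h
  push_cast at h
  linarith

/-- **Beukers–Kolk–Calabi, through the moves**: `∫_T ∏ 2dtᵢ/(1+tᵢ²) = π⁴/96`. -/
theorem tanPiece_value : tanPiece.value = Real.pi ^ 4 / 96 := by
  rw [← evenRep_value]
  exact Equivalent.value_eq_holds tanPiece_equiv_evenRep

end SoloBlind

end Summit.KontsevichZagierPeriods.KontsevichZagierPeriods.Theorems
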